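import Summits.BirchSwinnertonDyer.BirchSwinnertonDyer.Theorems.AlignedTransportAtTwoMainConjectureOfRankZeroBSDAtTwoTwinValueLambda
import Summits.BirchSwinnertonDyer.BirchSwinnertonDyer.Theorems.AlignedTransportAtTwoMainConjectureOfRankZeroBSDAtTwoRoadSecondFixedPoint
import Summits.BirchSwinnertonDyer.BirchSwinnertonDyer.Theorems.LambdaTransportDoorAtTwoValueAtMinusTwo
import Summits.BirchSwinnertonDyer.BirchSwinnertonDyer.Theorems.LambdaTransportDoorAtTwoMatsunoClassSign
import Literature.NumberTheory.EllipticCurves.LeadingTermPPartProofs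
import HarnessLib

/-!
# Route `AlignedTransportAtTwo`, crux C2 `MainConjectureOfRankZeroBSDAtTwo` (stmt-BirchSwinnertonDyer-22298):
# THE TWIN-VALUE DOOR ON THE ANALYTIC SIDE — C2's analytic-`μ` binder `red G ≠ 0` (and `λ(G) = 2`) for an even-branch lift `G` of
# `L₂(W,T)` from the two VALUES `G(0) = (1 − α⁻¹)²[0]⁺_f` and `α³G(−2) = S₈(f)`: `{ord₂ G(0), ord₂ G(−2)} ∋ 2`, distinct ⟹ `μ(G) = 0`, `λ(G) = 2`

HONEST FRAMING (cell `bsd-f1-sign2`, WIDTH-5 attached prover seat `bsd-line-att-p5` gen 49 on line `birth` of the lead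
`bsd-line-att-p2`; `--supports` stmt-BirchSwinnertonDyer-22298, closes nothing; BSD is NOT proved by any of this; the crux
C2, its verdict «blocked-on `Rank1Residual.GreenbergMuConjectureIrreducible`» and every registered stub are untouched).
THEOREMS ONLY — no `def`, no instance, no named fact, no `sorry`. No PRINT binder at all on the analytic side: the `ι`-stability of an
integral model of `L₂(W,T)` is the tree THEOREM `AlignedTransportAtTwoRoadSecondFixedPoint.exists_integral_functional_equation`
(Mazur–Tate–Teitelbaum functional equation at the conductor level, att-p5 g33), and the values are the tree THEOREMS
`constantCoeff_padicLFunction_unitRoot` (MTT at the trivial character) and `LambdaTransportDoorAtTwoValueAtMinusTwo.coe_unitRoot_pow_mul_evalAt_negTwo`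
(MTT at `χ₈`, bsd-rank2). Carayol's level theorem `hlev` enters only to serve C2's all-levels binder verbatim.

* §1 (algebra) `invSubOne_two_eq_invOnePlusSubOne` (the tree's two involution variables agree), `iotaStable_of_subst_eq_mul`,
  (`μ = 0 ⟹ red ≠ 0` is the tree's `LambdaTransportDoorAtTwoMatsunoClassSign.red_ne_zero_of_mu_zero`), ★ `red_ne_zero_and_lam_eq_two_of_twinValues` (an `ι`-stable `G` whose two values have orders `{2, ≠ 2}`
  has `red G ≠ 0` and `λ(G) = 2`).
* §2 (analytic, conductor level) `iotaStable_of_isEvenBranchLiftAtTwo`; `evalAt_negTwo_reading` (`α³G(−2) = S₈(f)`), `constantCoeff_reading`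
  (`G(0) = (1 − α⁻¹)²[0]⁺_f` in `ℚ₂`); ★★ `red_ne_zero_and_lam_eq_two_of_isEvenBranchLiftAtTwo`: **`{ord₂ G(0), ord₂ G(−2)} ∋ 2`, the two distinct
  ⟹ `red G ≠ 0 ∧ λ(G) = 2`**; `two_le_of_isEvenBranchLiftAtTwo` (**the analytic twin values are both `≤ 1` and equal, or both `≥ μ + 2`** —
  e.g. `v₂(S₈(f)) ≥ 2` whenever `v₂((1−α⁻¹)²[0]⁺) ≥ 2` and `S₈(f) ≠ 0`).
* §3 (C2's binder verbatim, all levels via `hlev`) ★★ `muAn_binder_of_twinValues`: for `W` good at `2` with the displayed per-curve value condition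
  at every even-branch lift, `∀ N f, IsNewformOf W f → ∀ G, IsEvenBranchLiftAtTwo W f G → red G ≠ 0`.

READING. `ord₂ G(0) = 2·ord₂ #Ẽ(𝔽₂) + v₂([0]⁺_f)` and `ord₂ G(−2) = v₂(S₈(f))`; on the clean `a₂ = +1` cell with unit central symbol (`‖[0]⁺_f‖₂ = 1`,
g46's «unit-symbol form») the door reads **`v₂(S₈(f)) ≥ 3 ⟹ μ_an = 0, λ_an = 2`**, and by `…TwinValueNecessity` the SAME number `v₂(S₈(f))`
is the algebraic twin value under MC₂. BSD is not proved by any of this.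

References: B. Mazur, J. Tate, J. Teitelbaum, Invent. Math. 84 (1986) §I.14, Ch. I §17 [MazurTateTeitelbaum1986Invent]; R. Greenberg, LNM 1716
(1999) §1 (functional equation), §5 p. 181 [GreenbergLNM1716]; H. Carayol, Ann. Sci. ÉNS 19 (1986) Thm. (A) [Carayol1986];
R. Greenberg, V. Vatsal, Invent. Math. 142 (2000) (2) [GreenbergVatsal2000].
-/

set_option linter.dupNamespace false
set_option autoImplicit false

noncomputable section

open scoped Classical MatrixGroups ModularForm

namespace Summit.BirchSwinnertonDyer.BirchSwinnertonDyer.Theorems.AlignedTransportAtTwoTwinValueAnalytic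

open PowerSeries CongruenceSubgroup WeierstrassCurve Literature.NumberTheory.EllipticCurves
  Literature.NumberTheory.EllipticCurves.IwasawaAlgebra
  Literature.NumberTheory.EllipticCurves.ModularForms Literature.Barriers.BirchSwinnertonDyer
  Summit.BirchSwinnertonDyer.Rank1Residual.X1.MuLambda Summit.BirchSwinnertonDyer.Rank1Residual.X1.ParitySqueeze
  Summit.BirchSwinnertonDyer.Rank1Residual.Supersingular Summit.BirchSwinnertonDyer.Rank1Residual.Supersingular.BlindLever
  Summit.BirchSwinnertonDyer.Rank1Residual.F1Sign2
  Summit.BirchSwinnertonDyer.BirchSwinnertonDyer.Theorems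
  Summit.BirchSwinnertonDyer.BirchSwinnertonDyer.Theorems.AlignedTransportAtTwoTwinValueAlgebra
  Summit.BirchSwinnertonDyer.BirchSwinnertonDyer.Theorems.AlignedTransportAtTwoTwinValueLambda
  Summit.BirchSwinnertonDyer.BirchSwinnertonDyer.Theorems.AlignedTransportAtTwoTwoFixedPoints
  Summit.BirchSwinnertonDyer.BirchSwinnertonDyer.Theorems.AlignedTransportAtTwoRoadSecondFixedPoint
  Summit.BirchSwinnertonDyer.BirchSwinnertonDyer.Theorems.LambdaTransportDoorAtTwoValueAtMinusTwo

/-! ## §1 Algebra: `ι`-stability from a functional equation; `red G ≠ 0` and `λ(G) = 2` from two values -/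

section Algebra

/-- The tree's two involution variables agree in `ℤ₂⟦T⟧`: `IwasawaAlgebra.invSubOne 2 = invOnePlusSubOne` (both are `(1+T)⁻¹ − 1`;
cf. `SignedKatoOffTwo.Invol.invSubOne_eq_invOnePlusSubOne`). [cite: MazurTateTeitelbaum1986Invent, Ch. I §17] -/
theorem invSubOne_two_eq_invOnePlusSubOne : invSubOne 2 = (invOnePlusSubOne : PowerSeries ℤ_[2]) :=
  (Greenberg1999.eq_invSubOne_of_one_add_X_mul_add_one_eq_one 2 (one_add_X_mul_invOnePlusSubOne_add_one (R := ℤ_[2]))).symm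

/-- A functional equation `G(T^ι) = v·G` with `G ≠ 0` makes the ideal `(G)` `ι`-stable in the `invol` currency: `ι G = u·G`, `u ∈ Λˣ`
(`v` is automatically a unit, tree `isUnit_of_subst_eq_mul`). [cite: GreenbergLNM1716, §1 (functional equation, pp. 67–68)] -/
theorem iotaStable_of_subst_eq_mul {G v : PowerSeries ℤ_[2]} (hG : G ≠ 0) (hFE : G.subst (invOnePlusSubOne : PowerSeries ℤ_[2]) = v * G) :
    ∃ u : (IwasawaAlgebra 2)ˣ, invol 2 G = u * G := by
  have hv : IsUnit v := isUnit_of_subst_eq_mul hG hFE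
  refine ⟨hv.unit, ?_⟩
  rw [invol_apply, invSubOne_two_eq_invOnePlusSubOne, hFE, IsUnit.unit_spec]

/-- ★ **Two values decide `red G ≠ 0` and `λ(G) = 2`.** For `G ≠ 0` in `ℤ₂⟦T⟧` with a functional equation `G(T^ι) = v·G`, `G(0) ≠ 0`,
`G(−2) ≠ 0`: if one of `ord₂ G(0)`, `ord₂ G(−2)` is `2` and the other is not, then `red G ≠ 0` (`μ(G) = 0`) and `λ(G) = 2`
(`…TwinValueLambda.lam_eq_two_of_twinValue`). [cite: GreenbergLNM1716, §1 and §4 p. 107] [cite: MazurTateTeitelbaum1986Invent, Ch. I §17] -/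
theorem red_ne_zero_and_lam_eq_two_of_twinValues {G v : PowerSeries ℤ_[2]} (hG : G ≠ 0)
    (hFE : G.subst (invOnePlusSubOne : PowerSeries ℤ_[2]) = v * G) (h0 : constantCoeff G ≠ 0) (h2 : evalAt (-2 : ℤ_[2]) G ≠ 0)
    (htwo : (constantCoeff G).valuation = 2 ∨ (evalAt (-2 : ℤ_[2]) G).valuation = 2)
    (hne : (constantCoeff G).valuation ≠ (evalAt (-2 : ℤ_[2]) G).valuation) : red G ≠ 0 ∧ lam G = 2 := by
  obtain ⟨hμ, hlam⟩ := lam_eq_two_of_twinValue hG (iotaStable_of_subst_eq_mul hG hFE) h0 h2 htwo hne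
  exact ⟨LambdaTransportDoorAtTwoMatsunoClassSign.red_ne_zero_of_mu_zero hG hμ, hlam⟩

/-- The analytic never-one: for `G ≠ 0` with a functional equation and `G(0)G(−2) ≠ 0`, `2 ≤ max ⟹ 2 ≤ min` of the two orders.
[cite: GreenbergLNM1716, §1 and §4 p. 107] -/
theorem two_le_min_of_subst_eq_mul {G v : PowerSeries ℤ_[2]} (hG : G ≠ 0)
    (hFE : G.subst (invOnePlusSubOne : PowerSeries ℤ_[2]) = v * G) (h0 : constantCoeff G ≠ 0) (h2 : evalAt (-2 : ℤ_[2]) G ≠ 0)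
    (hmax : 2 ≤ (constantCoeff G).valuation ∨ 2 ≤ (evalAt (-2 : ℤ_[2]) G).valuation) :
    2 ≤ (constantCoeff G).valuation ∧ 2 ≤ (evalAt (-2 : ℤ_[2]) G).valuation := by
  rcases twinValue_dichotomy _ G hG le_rfl (iotaStable_of_subst_eq_mul hG hFE) h0 h2 with h | ⟨ha, hb⟩
  · rcases hmax with hm | hm <;> constructor <;> omega
  · constructor <;> omega

end Algebra

/-! ## §2 The even-branch lift of `L₂(W,T)` at the conductor level -/

section Analytic

variable {W : WeierstrassCurve ℚ} [W.IsElliptic] [W.IsGloballyMinimal] [NeZero (W.conductorNorm ℤ)]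
  {f : CuspForm (Gamma0 (W.conductorNorm ℤ)) 2}

/-- **An even-branch lift is `ι`-stable** (good reduction at `2`): `IsEvenBranchLiftAtTwo W f G` means `ι G = L₂(f, α)` on the ordinary branch, and
the conductor-level functional equation (tree `exists_integral_functional_equation`) gives `G(T^ι) = w(W)(1+T)^e·G`.
[cite: GreenbergLNM1716, §1 (functional equation, pp. 67–68)] -/
theorem iotaStable_of_isEvenBranchLiftAtTwo (hgood : W.HasGoodReductionAtPrime 2) (hf : IsNewformOf W f) {G : IwasawaAlgebra 2}
    (hG : IsEvenBranchLiftAtTwo W f G) (hG0 : G ≠ 0) : ∃ u : (IwasawaAlgebra 2)ˣ, invol 2 G = u * G := by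
  obtain ⟨hord, hιG⟩ := isOrdinaryAt_and_eq_of_isEvenBranchLiftAtTwo hgood hG
  obtain ⟨e, -, hFE⟩ := exists_integral_functional_equation hord hf hιG
  exact iotaStable_of_subst_eq_mul hG0 hFE

/-- **The value at `−2` of an even-branch lift**: `α³ · G(−2) = S₈(f)` in `ℚ₂` (bsd-rank2's `coe_unitRoot_pow_mul_evalAt_negTwo` at `c = 1`).
[cite: MazurTateTeitelbaum1986Invent, §I.14 Proposition (p. 20)] -/
theorem evalAt_negTwo_reading (hgood : W.HasGoodReductionAtPrime 2) (hf : IsNewformOf W f) {G : IwasawaAlgebra 2}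
    (hG : IsEvenBranchLiftAtTwo W f G) :
    ((unitRoot W 2 ^ 3 * evalAt (-2 : ℤ_[2]) G : ℤ_[2]) : ℚ_[2]) =
      ((ratTwistedSymbolSum f (ZMod.χ₈.ringHomComp (Int.castRingHom ℚ)) : ℚ) : ℚ_[2]) := by
  obtain ⟨hord, hιG⟩ := isOrdinaryAt_and_eq_of_isEvenBranchLiftAtTwo hgood hG
  have h := coe_unitRoot_pow_mul_evalAt_negTwo hord hf hιG
  rwa [one_mul] at h

/-- **The value at `0` of an even-branch lift**: `G(0) = (1 − α⁻¹)² · [0]⁺_f` in `ℚ₂` (MTT at the trivial character, tree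
`constantCoeff_padicLFunction_unitRoot`). [cite: MazurTateTeitelbaum1986Invent, §I.14 (14.3)] -/
theorem constantCoeff_reading (hgood : W.HasGoodReductionAtPrime 2) (hf : IsNewformOf W f) {G : IwasawaAlgebra 2}
    (hG : IsEvenBranchLiftAtTwo W f G) :
    ((constantCoeff G : ℤ_[2]) : ℚ_[2]) = (1 - (unitRoot W 2 : ℚ_[2])⁻¹) ^ 2 * (ratPlusSymbol f 0 : ℚ_[2]) := by
  obtain ⟨hord, hιG⟩ := isOrdinaryAt_and_eq_of_isEvenBranchLiftAtTwo hgood hG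
  rw [map_one, one_mul] at hιG
  have h := congrArg PowerSeries.constantCoeff hιG
  rw [constantCoeff_iwasawaToPowerSeries, constantCoeff_padicLFunction_unitRoot hord hf] at h
  exact h

/-- ★★ **C2's ANALYTIC `μ`-BINDER FROM TWO VALUES (conductor level).** `W/ℚ` globally minimal, good at `2`, `f` its newform at level `N_W`,
`G` an even-branch lift (`IsEvenBranchLiftAtTwo W f G`, the `G` of crux C2's binder). If `G(0) ≠ 0`, `G(−2) ≠ 0`, one of
`ord₂ G(0)`, `ord₂ G(−2)` is `2` and the other is not, then **`red G ≠ 0`** (the binder `X1.MuLambda.red G ≠ 0`, i.e. `μ_an = 0`) **and `λ(G) = 2`**.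
Values: `G(0) = (1−α⁻¹)²[0]⁺_f`, `α³G(−2) = S₈(f)` (`constantCoeff_reading`, `evalAt_negTwo_reading`). NO PRINT binder.
[cite: MazurTateTeitelbaum1986Invent, §I.14 and Ch. I §17] [cite: GreenbergLNM1716, §1, §5 p. 181] -/
theorem red_ne_zero_and_lam_eq_two_of_isEvenBranchLiftAtTwo (hgood : W.HasGoodReductionAtPrime 2) (hf : IsNewformOf W f)
    {G : IwasawaAlgebra 2} (hG : IsEvenBranchLiftAtTwo W f G) (h0 : constantCoeff G ≠ 0) (h2 : evalAt (-2 : ℤ_[2]) G ≠ 0)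
    (htwo : (constantCoeff G).valuation = 2 ∨ (evalAt (-2 : ℤ_[2]) G).valuation = 2)
    (hne : (constantCoeff G).valuation ≠ (evalAt (-2 : ℤ_[2]) G).valuation) : red G ≠ 0 ∧ lam G = 2 := by
  have hG0 : G ≠ 0 := fun h ↦ h0 (by rw [h, map_zero])
  obtain ⟨hord, hιG⟩ := isOrdinaryAt_and_eq_of_isEvenBranchLiftAtTwo hgood hG
  obtain ⟨e, -, hFE⟩ := exists_integral_functional_equation hord hf hιG
  exact red_ne_zero_and_lam_eq_two_of_twinValues hG0 hFE h0 h2 htwo hne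

/-- ★ **The analytic twin values are never `{1, ≥ 2}`**: for an even-branch lift `G` with `G(0) ≠ 0`, `G(−2) ≠ 0`, `2 ≤ max` of the two orders
forces `2 ≤ min` — e.g. `2 ≤ ord₂((1−α⁻¹)²[0]⁺_f)` (automatic when `[0]⁺_f` is `2`-integral and `a₂` is odd) forces `2 ≤ v₂(S₈(f))`.
[cite: MazurTateTeitelbaum1986Invent, §I.14 and Ch. I §17] [cite: GreenbergLNM1716, §5 p. 181] -/
theorem two_le_of_isEvenBranchLiftAtTwo (hgood : W.HasGoodReductionAtPrime 2) (hf : IsNewformOf W f) {G : IwasawaAlgebra 2}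
    (hG : IsEvenBranchLiftAtTwo W f G) (h0 : constantCoeff G ≠ 0) (h2 : evalAt (-2 : ℤ_[2]) G ≠ 0)
    (hmax : 2 ≤ (constantCoeff G).valuation ∨ 2 ≤ (evalAt (-2 : ℤ_[2]) G).valuation) :
    2 ≤ (constantCoeff G).valuation ∧ 2 ≤ (evalAt (-2 : ℤ_[2]) G).valuation := by
  have hG0 : G ≠ 0 := fun h ↦ h0 (by rw [h, map_zero])
  obtain ⟨hord, hιG⟩ := isOrdinaryAt_and_eq_of_isEvenBranchLiftAtTwo hgood hG
  obtain ⟨e, -, hFE⟩ := exists_integral_functional_equation hord hf hιG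
  exact two_le_min_of_subst_eq_mul hG0 hFE h0 h2 hmax

end Analytic

/-! ## §3 C2's analytic-`μ` binder verbatim (all levels, via Carayol) -/

section Binder

variable (W : WeierstrassCurve ℚ) [W.IsElliptic] [W.IsGloballyMinimal]

/-- ★★ **C2's analytic-`μ` binder from the twin values, all levels.** `W/ℚ` globally minimal, good at `2`; Carayol's level theorem `hlev`
(`IsNewformOf.level_eq_conductorNorm`, PRINT). If at EVERY even-branch lift `G` of `L₂` of the conductor-level newform the two values satisfy
`G(0) ≠ 0`, `G(−2) ≠ 0`, `{ord₂ G(0), ord₂ G(−2)} ∋ 2` with the two distinct (a per-curve modular-symbol condition: `G(0) = (1−α⁻¹)²[0]⁺_f`,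
`α³G(−2) = S₈(f)`), then the binder of crux C2 holds for `W`:
`∀ N f, IsNewformOf W f → ∀ G, IsEvenBranchLiftAtTwo W f G → red G ≠ 0`. [cite: Carayol1986, Thm. (A)]
[cite: MazurTateTeitelbaum1986Invent, §I.14 and Ch. I §17] -/
theorem muAn_binder_of_twinValues (hlev : ∀ {N : ℕ} [NeZero N], IsNewformOf.level_eq_conductorNorm (N := N))
    (hgood : W.HasGoodReductionAtPrime 2)
    (hval : ∀ [NeZero (W.conductorNorm ℤ)] (f : CuspForm (Gamma0 (W.conductorNorm ℤ)) 2), IsNewformOf W f →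
      ∀ G : IwasawaAlgebra 2, IsEvenBranchLiftAtTwo W f G →
        constantCoeff G ≠ 0 ∧ evalAt (-2 : ℤ_[2]) G ≠ 0 ∧
        ((constantCoeff G).valuation = 2 ∨ (evalAt (-2 : ℤ_[2]) G).valuation = 2) ∧
        (constantCoeff G).valuation ≠ (evalAt (-2 : ℤ_[2]) G).valuation) :
    ∀ ⦃N : ℕ⦄ [NeZero N] (f : CuspForm (Gamma0 N) 2), IsNewformOf W f →
      ∀ G : IwasawaAlgebra 2, IsEvenBranchLiftAtTwo W f G → red G ≠ 0 := by
  intro N _ f hf G hG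
  have hN : N = W.conductorNorm ℤ := hlev hf
  subst hN
  obtain ⟨h0, h2, htwo, hne⟩ := hval f hf G hG
  exact (red_ne_zero_and_lam_eq_two_of_isEvenBranchLiftAtTwo hgood hf hG h0 h2 htwo hne).1

end Binder

end Summit.BirchSwinnertonDyer.BirchSwinnertonDyer.Theorems.AlignedTransportAtTwoTwinValueAnalytic

end
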